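import Summits.KontsevichZagierPeriods.Zeta5Search.WedgeDictionaryFan
import Summits.KontsevichZagierPeriods.Zeta5Search.WedgeDictionaryEdge
import HarnessLib

/-!
# The wedge dictionary at the shape `b = (n; 1, 1, 0⁵)` by rank two (cell `pub-zeta5`, P1)

HONEST FRAMING: systematic search; no irrationality claim unless certified.

OUR work (Summit side), P1 seat generation 3 — a shape OFF the fan, by gen-1 g4's rank-two reduction (`WedgeDictionaryRankTwo`):
`b = (n;1,1,0⁵)` (`WedgeDictionaryEdge.bEdge2`) has `Π_b = y²`, its partner `b + e₁ = (n;2,1,0⁵)` has `Π = y²(y + n − 1)`; with the summable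
`Φ₀, Φ₁` (`PhiZero`, `PhiOne`) the certificates are `y² = −n⁴/3 − (4n²/3)y − Φ₀/(3n)` and
`y²(y+n−1) = n⁴(2n−1)(2n²−2n+1)/(3(3n−1)) + n²(13n³−21n²+16n−4)/(3(3n−1))·y + (2n−1)(2n²−2n+1)/(3n(3n−1))·Φ₀ − Φ₁/(3n−1)`, hence
(`quadM3_shape_one_one`) `M₃(n;1,1,0⁵) = n⁸(n−1)/(3(3n−1))·M₃(n;0⁷) = (−1)ⁿ·4·(3n−2)!·n⁹(n−1)/n!¹⁵` for `n ≥ 1` — gen-1 g4's CF-M3 at this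
shape (decided per shape there; a Lean theorem here).
-/

noncomputable section

open Finset Polynomial

namespace Summit.KontsevichZagierPeriods.Zeta5Search.WedgeDictionary

open Summit.KontsevichZagierPeriods.Zeta5Search.DualSeries

/-- `Π_{(n;1,1,0⁵)} = X²`. -/
theorem PiPoly_bEdge2 (n : ℕ) : PiPoly (bEdge2 n) = X ^ 2 := by
  unfold PiPoly
  have hval : ∀ j ∈ range 7, (bEdge2 n (j + 1)).toNat = if j = 0 ∨ j = 1 then 1 else 0 := by
    intro j _
    rw [bEdge2_apply]
    by_cases h0 : j = 0
    · subst h0; simp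
    by_cases h1 : j = 1
    · subst h1; simp
    · simp [h0, h1]
  rw [prod_congr rfl fun j hj => by rw [hval j hj], show bEdge2 n 0 = (n : ℤ) by rw [bEdge2_apply]; simp]
  simp [prod_range_succ]
  ring

/-- The partner `(n;2,1,0⁵)` of `(n;1,1,0⁵)` as an explicit function. -/
theorem bEdge2_partner_eq (n : ℕ) : Function.update (bEdge2 n) (0 + 1) (bEdge2 n (0 + 1) + 1) =
    fun j => if j = 0 then (n : ℤ) else if j = 1 then 2 else if j = 2 then 1 else 0 := by
  funext j
  by_cases h1 : j = 1
  · subst h1; rw [Function.update_self, bEdge2_apply]; simp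
  · rw [Function.update_of_ne (by omega), bEdge2_apply]
    by_cases h0 : j = 0
    · simp [h0]
    · by_cases h2 : j = 2
      · subst h2; simp
      · simp [h0, h1, h2]

/-- `Π_{(n;2,1,0⁵)} = X²(X + (n−1))`. -/
theorem PiPoly_bEdge2_partner (n : ℕ) :
    PiPoly (Function.update (bEdge2 n) (0 + 1) (bEdge2 n (0 + 1) + 1)) = X ^ 2 * (X + C ((n : ℚ) - 1)) := by
  rw [bEdge2_partner_eq]
  unfold PiPoly
  simp (config := {decide := true}) only [prod_range_succ, prod_range_zero, if_true, if_false, Int.toNat_one,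
    Int.toNat_zero, one_mul, mul_one]
  apply Polynomial.funext; intro x
  simp [Finset.prod_range_succ]
  ring

/-- **The shape `(n;1,1,0⁵)` by rank two**: `M₃(n;1,1,0⁵) = n⁸(n−1)/(3(3n−1))·M₃(n;0⁷)` for `n ≥ 1`. -/
theorem quadM3_shape_one_one (n : ℕ) (hn : 1 ≤ n) :
    quadM3 (bEdge2 n) = (n : ℚ) ^ 8 * ((n : ℚ) - 1) / (3 * (3 * (n : ℚ) - 1)) * quadM3 (bCorner n) := by
  obtain ⟨hb, hsum⟩ := box_bEdge2 n hn
  have hN0 : (bEdge2 n 0).toNat = n := bEdge2_zero_toNat n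
  have hd : 0 ≤ dOf (bEdge2 n) := by
    unfold dOf
    rw [show bEdge2 n 0 = (n : ℤ) by rw [bEdge2_apply]; simp,
      show ∑ j ∈ range 7, bEdge2 n (j + 1) = 2 by simp only [sum_range_succ, sum_range_zero, bEdge2_apply]; norm_num]
    omega
  have hNq : (n : ℚ) ≠ 0 := by exact_mod_cast (show n ≠ 0 by omega)
  have hn' : (1 : ℚ) ≤ n := by exact_mod_cast hn
  have h31 : (3 * (n : ℚ) - 1) ≠ 0 := by intro h; linarith
  have key := quadM3_eq_of_rank_two (bEdge2 n) hb hd (by rw [hN0]; exact hn) (i := 0) (by simp)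
    (by rw [bEdge2_apply, bEdge2_apply]; simp; omega)
    {0, 1} (fun k => if k = 0 then PhiZero n else PhiOne n) (fun k => if k = 0 then 1 else X * (X + C ((n : ℚ) - 1)))
    (fun k => if k = 0 then -1 / (3 * (n : ℚ)) else 0)
    (fun k => if k = 0 then (2 * (n : ℚ) - 1) * (2 * (n : ℚ) ^ 2 - 2 * n + 1) / (3 * n * (3 * (n : ℚ) - 1))
      else -1 / (3 * (n : ℚ) - 1))
    (-(n : ℚ) ^ 4 / 3) (-(4 * (n : ℚ) ^ 2) / 3)
    ((n : ℚ) ^ 4 * (2 * (n : ℚ) - 1) * (2 * (n : ℚ) ^ 2 - 2 * n + 1) / (3 * (3 * (n : ℚ) - 1)))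
    ((n : ℚ) ^ 2 * (13 * (n : ℚ) ^ 3 - 21 * (n : ℚ) ^ 2 + 16 * n - 4) / (3 * (3 * (n : ℚ) - 1)))
    (fun k hk => by
      rw [hN0]
      simp only [mem_insert, mem_singleton] at hk
      rcases hk with rfl | rfl
      · simp only [if_true]; exact polyNum_PhiZero n
      · simp only [one_ne_zero, if_false]; exact polyNum_PhiOne n)
    (fun k hk => by
      rw [hN0]
      simp only [mem_insert, mem_singleton] at hk
      rcases hk with rfl | rfl
      · simp; omega
      · simp only [one_ne_zero, if_false]
        have : (X * (X + C ((n : ℚ) - 1))).natDegree ≤ 2 := by compute_degree!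
        omega)
    (by
      rw [PiPoly_bEdge2, sum_pair (by norm_num)]
      simp only [if_true, one_ne_zero, if_false, PhiZero]
      apply Polynomial.funext; intro x
      simp only [eval_add, eval_mul, eval_C, eval_X, eval_pow, eval_neg, neg_mul, zero_mul, add_zero]
      field_simp
      ring)
    (by
      rw [PiPoly_bEdge2_partner, sum_pair (by norm_num)]
      simp only [if_true, one_ne_zero, if_false, PhiZero, PhiOne]
      apply Polynomial.funext; intro x
      simp only [eval_add, eval_mul, eval_C, eval_X, eval_pow, eval_neg, neg_mul]
      set k := 3 * (n : ℚ) - 1 with hk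
      rw [show (1 - 3 * (n : ℚ)) = -k by rw [hk]; ring]
      field_simp
      rw [hk]
      ring)
  rw [key, hN0]
  congr 1
  set k := 3 * (n : ℚ) - 1 with hk
  field_simp
  ring

/-- **CF-M3 at the shape `(n;1,1,0⁵)`**: `M₃(n;1,1,0⁵) = (−1)ⁿ·4·(3n−2)!·n⁹(n−1)/n!¹⁵` for `n ≥ 1`. -/
theorem quadM3_shape_one_one_closed (n : ℕ) (hn : 1 ≤ n) :
    quadM3 (bEdge2 n) = (-1) ^ n * 4 * ((3 * n - 2).factorial : ℚ) * (n : ℚ) ^ 9 * ((n : ℚ) - 1) / (n.factorial : ℚ) ^ 15 := by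
  rw [quadM3_shape_one_one n hn, quadM3_bCorner]
  obtain ⟨m, rfl⟩ : ∃ m, n = m + 1 := ⟨n - 1, by omega⟩
  rw [show 3 * (m + 1) - 2 = 3 * m + 1 by omega]
  have hf : ((3 * (m + 1)).factorial : ℚ) = (3 * m + 3) * (3 * m + 2) * ((3 * m + 1).factorial : ℚ) := by
    rw [show 3 * (m + 1) = (3 * m + 1) + 1 + 1 by omega, Nat.factorial_succ, Nat.factorial_succ]
    push_cast
    ring
  rw [hf]
  push_cast
  rw [show (3 * ((m : ℚ) + 1) - 1) = 3 * m + 2 by ring]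
  have h2 : (3 * (m : ℚ) + 2) ≠ 0 := by positivity
  have hF : (((m + 1).factorial : ℕ) : ℚ) ≠ 0 := by positivity
  field_simp

end Summit.KontsevichZagierPeriods.Zeta5Search.WedgeDictionary
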